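import Summits.Ventures.Crystal3D.Theorems.StickyWulffConstantGenericWallFloorStackWalkRayCross
import HarnessLib

/-!
# `c₀ = 1` on EVERY priced cell of every `Σ3ᵏ` chain pair, from two ray words per grain
# (crux `GenericWallFloor`, stmt-Ventures-19480, line `WallLedgerG`)

HONEST FRAMING. Venture `Summits/Ventures/Crystal3D` (cell `crystal3d-full`), helper `--supports` the crux
`GenericWallFloor` of `route-Ventures-StickyWulffConstant`, REGISTERED line `WallLedgerG`, open stub
`stub_twoSlabAdhesion`.  Rung credit only; F-C1 not moved; NOT the crux: `ExactOnly`(C12-55) [E1] and `StarPairFar`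
[certified] stay BY NAME.

**`genericWallFloorAt_ray`.**  Let `A₂·Λ₀ = (wordFrame A₁ κ)·Λ₀` for a reduced model menu word `κ` of length `k ≥ 1`, let
`u₁` be a steep up-slot of grain 1 and `u₂` a steep down-slot of grain 2, and let `l + c + 1 ≤ k`.  Suppose the two
depth-`(l+1)` ray words of `(A₁, u₁)` (vertical `e₃`; one per admissible first push normal) are not the chain's first
`l + 1` letters and the two depth-`(c+1)` ray words of `(A₂, u₂)` (vertical `−e₃`) are not its last `c + 1` letters
(pulled back by `A₂⁻¹ ∘ wordFrame A₁ κ`) — i.e. grain 1's forced rays leave the twin chain at level `≤ l + 1` and grain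
2's at level `≤ c + 1` (ROUTE.md §84 R41t: the cells `(l', c')` with `l' ≤ l`, `c' ≤ c`).  Then
`GenericWallFloorAt A₁ t₁ A₂ t₂` — the matrix of the route decl, verbatim, `c₀ = 1` — modulo `ExactOnly`(C12-55) and
`StarPairFar` only: `inPlaneTwinData_of_coaxial_ray` puts the pair in the semantic priced class `InPlaneTwinOnlyAt`
(`inPlaneTwinOnlyAt_ray`), and `genericWallFloorAt_of_inPlaneTwinOnlyAt` (`…InPlaneTwinOnly`) concludes.
This subsumes the word-criterion capstones of 19480-p2 g4/g5 (`…AtOfLedger/AtOfFar/AtOfFarTwo`, `…Sigma9Holds`,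
`…Sigma27Full`: the cells with `l, c ≤ 1`) and covers every SEPARATED (`l + c ≤ k − 2`) and PRICED (`l + c = k − 1`)
cell for every `k`; numerically (seat folder `calc/cells_k3.py`) that is `83 % / 93 % / 98 %` of Haar `Σ9 / Σ27 / Σ81`
orientations.  The complement inside the chain pairs is the ARRIVAL class (`GenericWallFloorArrivalResidual`).
Packaged: `RayCellAt A₁ A₂` (the hypothesis list), `inPlaneTwinOnlyAt_of_rayCellAt`, `genericWallFloorAt_of_rayCellAt`.
WHAT THIS IS NOT: not the stub; the arrival class is untouched; F-C1 not moved.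
-/

noncomputable section

namespace Summit.Ventures.Crystal3D.Theorems

open Summit.Ventures.Crystal3D Finset
open Literature.MathematicalPhysics.StatisticalMechanics (fccStacking barlowStacking IsHaggSeq)
open scoped InnerProductSpace

/-- **Ray-checked chain pairs lie in the semantic priced class.** -/
theorem inPlaneTwinOnlyAt_ray {A₁ A₂ : EuclideanSpace ℝ (Fin 3) ≃ₗᵢ[ℝ] EuclideanSpace ℝ (Fin 3)}
    {u₁ u₂ : EuclideanSpace ℝ (Fin 3)} (hu₁ : u₁ ∈ fccSlots)
    (hsteep₁ : Real.sqrt 2 / 2 ≤ ⟪A₁ u₁, EuclideanSpace.single (2 : Fin 3) (1 : ℝ)⟫_ℝ) (hu₂ : u₂ ∈ fccSlots)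
    (hsteep₂ : ⟪A₂ u₂, EuclideanSpace.single (2 : Fin 3) (1 : ℝ)⟫_ℝ ≤ -(Real.sqrt 2 / 2))
    (κ : List (EuclideanSpace ℝ (Fin 3))) (l c : ℕ)
    (hκl : ∀ μ ∈ κ, ‖μ‖ = 1 ∧
      ∀ w ∈ fccSlots, ⟪w, μ⟫_ℝ = 0 ∨ ⟪w, μ⟫_ℝ = Real.sqrt (2 / 3) ∨ ⟪w, μ⟫_ℝ = -Real.sqrt (2 / 3))
    (hκc : List.IsChain (fun μ μ' => ⟪μ, μ'⟫_ℝ = 1 / 3 ∨ ⟪μ, μ'⟫_ℝ = -1 / 3) κ)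
    (hlc : l + c + 1 ≤ κ.length)
    (hA₂ : A₂ '' fccStacking 1 (Real.sqrt (2 / 3)) = (wordFrame A₁ κ) '' fccStacking 1 (Real.sqrt (2 / 3)))
    (hray₁ : ∀ n : EuclideanSpace ℝ (Fin 3), ‖n‖ = 1 →
      (∀ w ∈ fccSlots, ⟪A₁ w, n⟫_ℝ = 0 ∨ ⟪A₁ w, n⟫_ℝ = Real.sqrt (2 / 3) ∨ ⟪A₁ w, n⟫_ℝ = -Real.sqrt (2 / 3)) →
      ⟪A₁ u₁, n⟫_ℝ = Real.sqrt (2 / 3) →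
      (rayWord (EuclideanSpace.single (2 : Fin 3) (1 : ℝ)) ⟨A₁, u₁, 0⟩ n (l + 1)).map (fun μ => (ℝ ∙ μ)ᗮ.reflection) ≠
        (κ.drop (κ.length - (l + 1))).map (fun μ => (ℝ ∙ μ)ᗮ.reflection))
    (hray₂ : ∀ n : EuclideanSpace ℝ (Fin 3), ‖n‖ = 1 →
      (∀ w ∈ fccSlots, ⟪A₂ w, n⟫_ℝ = 0 ∨ ⟪A₂ w, n⟫_ℝ = Real.sqrt (2 / 3) ∨ ⟪A₂ w, n⟫_ℝ = -Real.sqrt (2 / 3)) →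
      ⟪A₂ u₂, n⟫_ℝ = Real.sqrt (2 / 3) →
      (rayWord (-EuclideanSpace.single (2 : Fin 3) (1 : ℝ)) ⟨A₂, u₂, 0⟩ n (c + 1)).map (fun μ => (ℝ ∙ μ)ᗮ.reflection) ≠
        (((κ.take (c + 1)).reverse).map (fun μ => A₂.symm (wordFrame A₁ κ μ))).map (fun μ => (ℝ ∙ μ)ᗮ.reflection)) :
    InPlaneTwinOnlyAt A₁ A₂ :=
  ⟨u₁, hu₁, hsteep₁, u₂, hu₂, hsteep₂, fun _ _ _ _ hS₁ hW₁ hl₁ hS₂ hW₂ hl₂ hco =>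
    Or.inl (inPlaneTwinData_of_coaxial_ray κ l c hκl hκc hlc hA₂ hray₁ hray₂ hS₁ hW₁ hl₁ hS₂ hW₂ hl₂ hco)⟩

open scoped Classical in
/-- **`GenericWallFloorAt` (c₀ = 1) on every ray-checked chain pair**, modulo `ExactOnly`(C12-55) and `StarPairFar`.
See the module docstring. -/
theorem genericWallFloorAt_ray
    {s₀ : EuclideanSpace ℝ (Fin 3)} (hs₀ : s₀ ∈ fccSlots)
    (hcert : ExactOnly 0 (fccSlots.filter fun w => 0 < ⟪w, s₀⟫_ℝ)) (hfar : StarPairFar)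
    (A₁ : EuclideanSpace ℝ (Fin 3) ≃ₗᵢ[ℝ] EuclideanSpace ℝ (Fin 3)) (t₁ : EuclideanSpace ℝ (Fin 3))
    (A₂ : EuclideanSpace ℝ (Fin 3) ≃ₗᵢ[ℝ] EuclideanSpace ℝ (Fin 3)) (t₂ : EuclideanSpace ℝ (Fin 3))
    {u₁ u₂ : EuclideanSpace ℝ (Fin 3)} (hu₁ : u₁ ∈ fccSlots)
    (hsteep₁ : Real.sqrt 2 / 2 ≤ ⟪A₁ u₁, EuclideanSpace.single (2 : Fin 3) (1 : ℝ)⟫_ℝ) (hu₂ : u₂ ∈ fccSlots)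
    (hsteep₂ : ⟪A₂ u₂, EuclideanSpace.single (2 : Fin 3) (1 : ℝ)⟫_ℝ ≤ -(Real.sqrt 2 / 2))
    (κ : List (EuclideanSpace ℝ (Fin 3))) (l c : ℕ)
    (hκl : ∀ μ ∈ κ, ‖μ‖ = 1 ∧
      ∀ w ∈ fccSlots, ⟪w, μ⟫_ℝ = 0 ∨ ⟪w, μ⟫_ℝ = Real.sqrt (2 / 3) ∨ ⟪w, μ⟫_ℝ = -Real.sqrt (2 / 3))
    (hκc : List.IsChain (fun μ μ' => ⟪μ, μ'⟫_ℝ = 1 / 3 ∨ ⟪μ, μ'⟫_ℝ = -1 / 3) κ)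
    (hlc : l + c + 1 ≤ κ.length)
    (hA₂ : A₂ '' fccStacking 1 (Real.sqrt (2 / 3)) = (wordFrame A₁ κ) '' fccStacking 1 (Real.sqrt (2 / 3)))
    (hray₁ : ∀ n : EuclideanSpace ℝ (Fin 3), ‖n‖ = 1 →
      (∀ w ∈ fccSlots, ⟪A₁ w, n⟫_ℝ = 0 ∨ ⟪A₁ w, n⟫_ℝ = Real.sqrt (2 / 3) ∨ ⟪A₁ w, n⟫_ℝ = -Real.sqrt (2 / 3)) →
      ⟪A₁ u₁, n⟫_ℝ = Real.sqrt (2 / 3) →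
      (rayWord (EuclideanSpace.single (2 : Fin 3) (1 : ℝ)) ⟨A₁, u₁, 0⟩ n (l + 1)).map (fun μ => (ℝ ∙ μ)ᗮ.reflection) ≠
        (κ.drop (κ.length - (l + 1))).map (fun μ => (ℝ ∙ μ)ᗮ.reflection))
    (hray₂ : ∀ n : EuclideanSpace ℝ (Fin 3), ‖n‖ = 1 →
      (∀ w ∈ fccSlots, ⟪A₂ w, n⟫_ℝ = 0 ∨ ⟪A₂ w, n⟫_ℝ = Real.sqrt (2 / 3) ∨ ⟪A₂ w, n⟫_ℝ = -Real.sqrt (2 / 3)) →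
      ⟪A₂ u₂, n⟫_ℝ = Real.sqrt (2 / 3) →
      (rayWord (-EuclideanSpace.single (2 : Fin 3) (1 : ℝ)) ⟨A₂, u₂, 0⟩ n (c + 1)).map (fun μ => (ℝ ∙ μ)ᗮ.reflection) ≠
        (((κ.take (c + 1)).reverse).map (fun μ => A₂.symm (wordFrame A₁ κ μ))).map (fun μ => (ℝ ∙ μ)ᗮ.reflection)) :
    GenericWallFloorAt A₁ t₁ A₂ t₂ :=
  genericWallFloorAt_of_inPlaneTwinOnlyAt hs₀ hcert hfar
    (inPlaneTwinOnlyAt_ray hu₁ hsteep₁ hu₂ hsteep₂ κ l c hκl hκc hlc hA₂ hray₁ hray₂) t₁ t₂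

/-- **The RAY CELL class**: the hypothesis list of `genericWallFloorAt_ray` for the pair `(A₁, A₂)` — a chain word, two
steep slots, levels `l, c` with `l + c + 1 ≤ |κ|`, and the four ray-word inequalities. -/
def RayCellAt (A₁ A₂ : EuclideanSpace ℝ (Fin 3) ≃ₗᵢ[ℝ] EuclideanSpace ℝ (Fin 3)) : Prop :=
  ∃ (u₁ u₂ : EuclideanSpace ℝ (Fin 3)) (κ : List (EuclideanSpace ℝ (Fin 3))) (l c : ℕ),
    u₁ ∈ fccSlots ∧ Real.sqrt 2 / 2 ≤ ⟪A₁ u₁, EuclideanSpace.single (2 : Fin 3) (1 : ℝ)⟫_ℝ ∧ u₂ ∈ fccSlots ∧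
    ⟪A₂ u₂, EuclideanSpace.single (2 : Fin 3) (1 : ℝ)⟫_ℝ ≤ -(Real.sqrt 2 / 2) ∧
    (∀ μ ∈ κ, ‖μ‖ = 1 ∧
      ∀ w ∈ fccSlots, ⟪w, μ⟫_ℝ = 0 ∨ ⟪w, μ⟫_ℝ = Real.sqrt (2 / 3) ∨ ⟪w, μ⟫_ℝ = -Real.sqrt (2 / 3)) ∧
    List.IsChain (fun μ μ' => ⟪μ, μ'⟫_ℝ = 1 / 3 ∨ ⟪μ, μ'⟫_ℝ = -1 / 3) κ ∧ l + c + 1 ≤ κ.length ∧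
    A₂ '' fccStacking 1 (Real.sqrt (2 / 3)) = (wordFrame A₁ κ) '' fccStacking 1 (Real.sqrt (2 / 3)) ∧
    (∀ n : EuclideanSpace ℝ (Fin 3), ‖n‖ = 1 →
      (∀ w ∈ fccSlots, ⟪A₁ w, n⟫_ℝ = 0 ∨ ⟪A₁ w, n⟫_ℝ = Real.sqrt (2 / 3) ∨ ⟪A₁ w, n⟫_ℝ = -Real.sqrt (2 / 3)) →
      ⟪A₁ u₁, n⟫_ℝ = Real.sqrt (2 / 3) →
      (rayWord (EuclideanSpace.single (2 : Fin 3) (1 : ℝ)) ⟨A₁, u₁, 0⟩ n (l + 1)).map (fun μ => (ℝ ∙ μ)ᗮ.reflection) ≠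
        (κ.drop (κ.length - (l + 1))).map (fun μ => (ℝ ∙ μ)ᗮ.reflection)) ∧
    (∀ n : EuclideanSpace ℝ (Fin 3), ‖n‖ = 1 →
      (∀ w ∈ fccSlots, ⟪A₂ w, n⟫_ℝ = 0 ∨ ⟪A₂ w, n⟫_ℝ = Real.sqrt (2 / 3) ∨ ⟪A₂ w, n⟫_ℝ = -Real.sqrt (2 / 3)) →
      ⟪A₂ u₂, n⟫_ℝ = Real.sqrt (2 / 3) →
      (rayWord (-EuclideanSpace.single (2 : Fin 3) (1 : ℝ)) ⟨A₂, u₂, 0⟩ n (c + 1)).map (fun μ => (ℝ ∙ μ)ᗮ.reflection) ≠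
        (((κ.take (c + 1)).reverse).map (fun μ => A₂.symm (wordFrame A₁ κ μ))).map (fun μ => (ℝ ∙ μ)ᗮ.reflection))

/-- The ray cell class lies in the semantic priced class. -/
theorem inPlaneTwinOnlyAt_of_rayCellAt {A₁ A₂ : EuclideanSpace ℝ (Fin 3) ≃ₗᵢ[ℝ] EuclideanSpace ℝ (Fin 3)}
    (h : RayCellAt A₁ A₂) : InPlaneTwinOnlyAt A₁ A₂ := by
  obtain ⟨u₁, u₂, κ, l, c, hu₁, hsteep₁, hu₂, hsteep₂, hκl, hκc, hlc, hA₂, hray₁, hray₂⟩ := h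
  exact inPlaneTwinOnlyAt_ray hu₁ hsteep₁ hu₂ hsteep₂ κ l c hκl hκc hlc hA₂ hray₁ hray₂

/-- **`GenericWallFloorAt` on the ray cell class**, modulo `ExactOnly`(C12-55) and `StarPairFar`. -/
theorem genericWallFloorAt_of_rayCellAt
    {s₀ : EuclideanSpace ℝ (Fin 3)} (hs₀ : s₀ ∈ fccSlots)
    (hcert : ExactOnly 0 (fccSlots.filter fun w => 0 < ⟪w, s₀⟫_ℝ)) (hfar : StarPairFar)
    {A₁ A₂ : EuclideanSpace ℝ (Fin 3) ≃ₗᵢ[ℝ] EuclideanSpace ℝ (Fin 3)} (h : RayCellAt A₁ A₂)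
    (t₁ t₂ : EuclideanSpace ℝ (Fin 3)) : GenericWallFloorAt A₁ t₁ A₂ t₂ :=
  genericWallFloorAt_of_inPlaneTwinOnlyAt hs₀ hcert hfar (inPlaneTwinOnlyAt_of_rayCellAt h) t₁ t₂

/-- Hence pairs in the ray cell class are outside the arrival residual's scope: the residual owes nothing there. -/
theorem not_rayCellAt_of_not_inPlaneTwinOnlyAt {A₁ A₂ : EuclideanSpace ℝ (Fin 3) ≃ₗᵢ[ℝ] EuclideanSpace ℝ (Fin 3)}
    (h : ¬ InPlaneTwinOnlyAt A₁ A₂) : ¬ RayCellAt A₁ A₂ :=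
  fun h' => h (inPlaneTwinOnlyAt_of_rayCellAt h')

end Summit.Ventures.Crystal3D.Theorems

end
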